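import Summits.BirchSwinnertonDyer.Rank1Residual.X9.TransportHasseWeil
import Summits.BirchSwinnertonDyer.Rank1Residual.X9.TransportHasseWeilRecordsD
import Summits.BirchSwinnertonDyer.Rank1Residual.X9.TransportPairsD
import Summits.BirchSwinnertonDyer.Rank1Residual.X9.HessePartnerRecordsO
import Summits.BirchSwinnertonDyer.Rank1Residual.X9.S4DescentPairsZimmertE
import HarnessLib

/-!
# Class X9, `p = 5`: congruence-transport records RE-KEYED on the Hasse–Weil twin of Kraus–Oesterlé Prop. 4 — part F (5 records; KO92 R-20 repair, step 2)

HONEST FRAMING (cell `b2b-bsdres-*`, verbatim): the cell deletes COMBINATION-SHAPED residual classes of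
the rank-≤1 BSD formula from PUBLISHED theorems only and TYPES the construction-shaped remainder; this
is not "finishing BSD". Class X9 (good ordinary `p ≥ 5`, `ρ̄_{E,p}` irreducible and not surjective) stays
TYPED at class level; everything here is PER PAIR (or generic); no lane verdict is changed; no named fact is
introduced; nothing is booked by this unit (the lane books, the referee rules). Unit `b2b-bsdres-x9`, gen 47.

## Why (the KO92 clause defect, ARM-P register R-20 `KO92-Prop4-(ii)b-frobeniusTrace-offset`, 2026-08-27)

The cited-facts audit (`pub/bsd-cited`, sheet `D-AUDIT-r07-Q41-KO92-LS18.md`) found that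
`KrausOesterle1992.prop4_torsionIso_of_congruences` types Prop. 4 (ii)'s clause "`ℓ ∣ NN'`, `ℓ² ∤ NN'` ⇒
`a_ℓ a'_ℓ ≡ ℓ + 1 (mod p)`" over the tree's `frobeniusTrace`, which at the multiplicative curve of such a pair is
`2` / `0` (`= 1 + a_ℓ`; `X11b.LocalTorsion.frobeniusTrace_eq_two_of_split` / `…_zero_of_nonsplit`), not the
Hasse–Weil `a_ℓ = ±1` the paper multiplies (Math. Ann. 293, p. 263 L8–9). Every X9 congruence-transport record displays
that list on a pair whose `N_E·N_A` has a simple prime far below `μ(M)/6` (x9 GEN 47 owner census: 35 / 35 EXPOSED),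
so each is VACUOUS AS TYPED, while its two-engine certificate (Hasse–Weil `a_ℓ`) stands. The typing layer lands the
corrected twin `KrausOesterle1992.prop4_torsionIso_of_congruences_hasseWeil` (target T-Q41-1; the `= 1 →` conjunct over
`W.LFunction ℓ * W'.LFunction ℓ`, Mathlib's `WeierstrassCurve.LFunction` having the Hasse–Weil `a_ℓ` as prime
coefficient at EVERY prime); the X9 lane re-keys its consumers on it: step 0 `X9/TransportTorsionIso.lean` (p494287,
consumers keyed on the isomorphism), step 1 `X9/TransportHasseWeil.lean` (generic), step 2 these record files.

(This part imports part D only; the `168948a1` twin is re-derived through the generic layer rather than through part E's twin.)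

## Records in this part (each = the original's statement with `hKO` := the twin and ONE token in `hcong`; proof = the original's, through the `_hasseWeil` generic layer; the originals stay in the tree byte-identical — their status as closed statements is ARM-P target T-Q41-2's, not this lane's)

* `mazurMainConjecture_t199988e1_hasseWeil` ← `X9/TransportPairsD.lean`'s `mazurMainConjecture_t199988e1` (199988e1 ← 484364c1; exposing prime(s) 173, 419)
* `bsdp_t180336c1_of_bsdp_t13872bk1_hasseWeil` ← `X9/HessePartnerRecordsO.lean`'s `bsdp_t180336c1_of_bsdp_t13872bk1` (180336c1 ← 13872bk1; exposing prime(s) 13)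
* `bsdp_t180336c1_of_bsdp_t32368bb1_hasseWeil` ← `X9/HessePartnerRecordsO.lean`'s `bsdp_t180336c1_of_bsdp_t32368bb1` (180336c1 ← 32368bb1; exposing prime(s) 3, 7, 13)
* `bsdp_t180336c1_of_bsdp_h13872bk1_f1_m80_1_hasseWeil` ← `X9/HessePartnerRecordsO.lean`'s `bsdp_t180336c1_of_bsdp_h13872bk1_f1_m80_1` (180336c1 ← 13872bk1; exposing prime(s) 13)
* `bsdp_t168948a1_hasseWeil'` ← `X9/S4DescentPairsZimmertE.lean`'s `bsdp_t168948a1'` (168948a1 ← 12996j1; exposing prime(s) 13)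

No certificate is recomputed: the engines (PARI `ellap`; ENGINE D) computed Hasse–Weil `a_ℓ` — print's clause — in the kits named
in each docstring. References: as in the original files; Kraus–Oesterlé, Math. Ann. 293 (1992) Prop. 4 (ii), pp. 263–264.
-/

set_option autoImplicit false

noncomputable section

open scoped Classical MatrixGroups ModularForm

open CongruenceSubgroup WeierstrassCurve Literature.NumberTheory.EllipticCurves
  Literature.NumberTheory.EllipticCurves.ModularForms Literature.NumberTheory.EllipticCurves.Rank1Residual
  Literature.NumberTheory.EllipticCurves.Rank1Residual.Typed
  Literature.NumberTheory.EllipticCurves.Rank1Residual.X11RankOneCertificates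
  Literature.NumberTheory.EllipticCurves.Fisher2012
  Summit.BirchSwinnertonDyer.BirchSwinnertonDyer.Rank1Residual.IntModel
  Summit.BirchSwinnertonDyer.BirchSwinnertonDyer.Rank1Residual.X11RankOne
  Summit.BirchSwinnertonDyer.Rank1Residual.X11b

namespace Summit.BirchSwinnertonDyer.Rank1Residual.X9

/-! ### The re-keyed records -/

/-- **`BSD(E,5)`-side record for `199988e1` from `484364c1`, RE-KEYED on the Hasse–Weil twin of Kraus–Oesterlé Prop. 4** (ARM-P register
R-20 `KO92-Prop4-(ii)b-frobeniusTrace-offset`; x9 GEN 47 census `HOME/b2b-bsdres-x9/g47/KO92-EXPOSURE-X9.md`): the record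
`mazurMainConjecture_t199988e1` of `X9/TransportPairsD.lean` — same Cremona models, same kernel-decided data (its `card_*` / `isElliptic_*` /
`isGloballyMinimal_*` theorems are imported, not re-proved), same PUBLISHED and FINITE binders (see that docstring for every number) —
with (i) `hKO` := the corrected statement `KrausOesterle1992.prop4_torsionIso_of_congruences_hasseWeil` and (ii) the `v_ℓ(N_E N_A) = 1`
conjunct of the displayed list `hcong` over `W.LFunction ℓ * A.LFunction ℓ` — Mathlib's `WeierstrassCurve.LFunction`, whose prime
coefficient is the HASSE–WEIL `a_ℓ`, `= ±1` at the multiplicative curve (Kraus–Oesterlé, Math. Ann. 293, p. 263 L8–9) — instead of the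
tree's `frobeniusTrace` (`= 2 / 0` there, `X11b.LocalTorsion.frobeniusTrace_eq_two_of_split` / `…_zero_of_nonsplit`), which made the
original's `hcong` unsatisfiable at the simple prime(s) ℓ ∈ {173, 419} of `N_E·N_A` and the original VACUOUS AS TYPED. Hasse–Weil `a_ℓ` is the
currency in which the two engines (PARI `ellap`; ENGINE D pure-Python BSGS/Mestre; kit j127638) CERTIFIED the list: no certificate changes.
Per pair; nothing booked; X9 stays typed. [cite: KrausOesterle1992, Prop. 4 (ii), pp. 263–264] [cite: GreenbergVatsal2000, Thm. (1.4) (arXiv p. 5)]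
[cite: Cremona2006, Table 1 (Cremona labels 199988e1, 484364c1)] -/
theorem mazurMainConjecture_t199988e1_hasseWeil
    (hKO : KrausOesterle1992.prop4_torsionIso_of_congruences_hasseWeil)
    (hBCS : burungale_castella_skinner_charIdeal_eq_padicLFunction)
    (hGr : greenberg_charValue_rankZero) (h5 : realPeriodRat_eq_unit_mul_plusPeriod)
    (hGV : GreenbergVatsal2000.thm14_mainConjecture_transfer_of_torsionIso)
    (hS : Schneider1985_order_charGenerator) (hPR : perrinRiou_rankOne_leadingTerms)
    (hmodP : nonempty_modularParametrizationData) (hmodL : hasEntireLFunction_rat)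
    (hGZK : rank_eq_analyticRank_of_analyticRank_le_one)
    (W A : WeierstrassCurve ℚ) [W.IsElliptic] [W.IsGloballyMinimal] [A.IsElliptic] [A.IsGloballyMinimal]
    [Fact (Nat.Prime 5)]
    (hW : W = ⟨0, 0, 0, -41642588, -103238220075⟩) (hA : A = ⟨0, 0, 0, 35688032, 215988312756⟩)
    (hr : W.analyticRank = 0) (hrA : A.analyticRank ≤ 1)
    {qA : ℚ} (hqA : shaAn A = (qA : ℂ)) (hvA : padicValRat 5 qA = 0)
    (hSelA : Nat.card (A.selmerGroup (5 : ℤ)) = 5 ^ A.analyticRank)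
    (hSchA : A.analyticRank = 1 → ∀ Dh : PAdicHeightData A 5, Dh.IsCanonical → SchneiderConjecture Dh)
    (hcertA : ∀ [NeZero (A.conductorNorm ℤ)] (fA : CuspForm (Gamma0 (A.conductorNorm ℤ)) 2),
        IsNewformOf A fA → ∀ (ϖ : ℚ), (ϖ : ℝ) * A.realPeriodRat = plusPeriod fA →
      ∃ n : ℕ, ‖PowerSeries.coeff n
        (PowerSeries.C (ϖ : ℚ_[5]) * padicLFunction fA (unitRoot A 5 : ℚ_[5]))‖ = 1)
    (hcong : ∀ (ℓ : ℕ) [Fact ℓ.Prime],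
      6 * ℓ < KrausOesterle1992.gammaZeroIndex (KrausOesterle1992.modulus W A) →
      (padicValNat ℓ (W.conductorNorm ℤ * A.conductorNorm ℤ) = 0 →
          (5 : ℤ) ∣ W.frobeniusTrace ℓ - A.frobeniusTrace ℓ) ∧
        (padicValNat ℓ (W.conductorNorm ℤ * A.conductorNorm ℤ) = 1 →
          (5 : ℤ) ∣ W.LFunction ℓ * A.LFunction ℓ - (ℓ + 1)))
    (hcert : ∀ [NeZero (W.conductorNorm ℤ)] (f : CuspForm (Gamma0 (W.conductorNorm ℤ)) 2),
        IsNewformOf W f → ∀ (ϖ : ℚ), (ϖ : ℝ) * W.realPeriodRat = plusPeriod f →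
      ∃ n : ℕ, ‖PowerSeries.coeff n
        (PowerSeries.C (ϖ : ℚ_[5]) * padicLFunction f (unitRoot W 5 : ℚ_[5]))‖ = 1) :
    ∀ (κ : ZpExtension ℚ 5) (γ : Field.absoluteGaloisGroup ℚ),
        κ.IsCyclotomic → κ.IsTopGenerator γ → IsCyclotomicVariable 5 γ →
      ∀ [NeZero (W.conductorNorm ℤ)] (f : CuspForm (Gamma0 (W.conductorNorm ℤ)) 2),
        IsNewformOf W f → ∀ (ϖ : ℚ), (ϖ : ℝ) * W.realPeriodRat = plusPeriod f →
      ∀ (D : W.SelmerDualData κ γ), D.IsTorsion ∧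
        ∃ g : IwasawaAlgebra 5, D.charIdeal = Ideal.span {g} ∧
          GreenbergVatsal2000.HasUnitContent g ∧
          iwasawaToPowerSeries 5 g =
            PowerSeries.C (ϖ : ℚ_[5]) * padicLFunction f (unitRoot W 5 : ℚ_[5]) := by
  have hbsd : BSDp W 5 := bsdp_t199988e1_hasseWeil hKO hBCS hGr h5 hGV hS hPR hmodP hmodL hGZK W A hW hA hr hrA
    hqA hvA hSelA hSchA hcertA hcong
  have hIW : integralModelInt W = ⟨0, 0, 0, -41642588, -103238220075⟩ :=
    integralModelInt_eq_of_map_eq _ (by rw [hW]; ext <;> simp [WeierstrassCurve.map])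
  have hΔ : (⟨0, 0, 0, -41642588, -103238220075⟩ : WeierstrassCurve ℤ).Δ =
      discOf [0, 0, 0, -41642588, -103238220075] := intCurve_Δ 0 0 0 (-41642588) (-103238220075)
  have hgood : W.HasGoodReductionAtPrime 5 :=
    hasGoodReductionAtPrime_of_not_dvd W 5 (by rw [minimalDiscriminantInt_eq hIW, hΔ]; decide +kernel)
  have hord : ¬ (5 : ℤ) ∣ W.frobeniusTrace 5 := by rw [frobeniusTrace_eq hIW card_t199988e1_5]; decide
  haveI : Fact (Nat.Prime 3) := ⟨by norm_num⟩
  have hnoroot : ∀ t : ℕ, t < (5 : ℕ) →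
      ¬ ((5 : ℕ) : ℤ) ∣ (t : ℤ) ^ 2 - (((3 : ℕ) : ℤ) + 1 - (4 : ℕ)) * t + (3 : ℕ) := by
    decide
  have hirr : W.HasIrreducibleModPGaloisRep 5 := by
    refine hasIrreducibleModPGaloisRep_of_intModel_of_noroot hIW 5 3 (by decide) (by rw [hΔ]; decide +kernel)
      card_t199988e1_3 (forall_zmod_of_forall_lt fun t ht h0 ↦ hnoroot t ht ?_)
    rw [← ZMod.intCast_zmod_eq_zero_iff_dvd]
    push_cast at h0 ⊢
    linear_combination h0
  exact mazurMainConjecture_with_mu_zero_of_bsdp hBCS hGr h5 hmodL hGZK W 5 (by norm_num) hgood hord hirr hr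
    hbsd hcert

/-- **`BSD(E,5)`-side record for `180336c1` from `13872bk1`, RE-KEYED on the Hasse–Weil twin of Kraus–Oesterlé Prop. 4** (ARM-P register
R-20 `KO92-Prop4-(ii)b-frobeniusTrace-offset`; x9 GEN 47 census `HOME/b2b-bsdres-x9/g47/KO92-EXPOSURE-X9.md`): the record
`bsdp_t180336c1_of_bsdp_t13872bk1` of `X9/HessePartnerRecordsO.lean` — same Cremona models, same kernel-decided data (its `card_*` / `isElliptic_*` /
`isGloballyMinimal_*` theorems are imported, not re-proved), same PUBLISHED and FINITE binders (see that docstring for every number) —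
with (i) `hKO` := the corrected statement `KrausOesterle1992.prop4_torsionIso_of_congruences_hasseWeil` and (ii) the `v_ℓ(N_E N_A) = 1`
conjunct of the displayed list `hcong` over `W.LFunction ℓ * A.LFunction ℓ` — Mathlib's `WeierstrassCurve.LFunction`, whose prime
coefficient is the HASSE–WEIL `a_ℓ`, `= ±1` at the multiplicative curve (Kraus–Oesterlé, Math. Ann. 293, p. 263 L8–9) — instead of the
tree's `frobeniusTrace` (`= 2 / 0` there, `X11b.LocalTorsion.frobeniusTrace_eq_two_of_split` / `…_zero_of_nonsplit`), which made the
original's `hcong` unsatisfiable at the simple prime(s) ℓ ∈ {13} of `N_E·N_A` and the original VACUOUS AS TYPED. Hasse–Weil `a_ℓ` is the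
currency in which the two engines (PARI `ellap`; ENGINE D pure-Python BSGS/Mestre; kit j159498) CERTIFIED the list: no certificate changes.
Per pair; nothing booked; X9 stays typed. [cite: KrausOesterle1992, Prop. 4 (ii), pp. 263–264] [cite: GreenbergVatsal2000, Thm. (1.4) (arXiv p. 5)]
[cite: Cremona2006, Table 1 (Cremona labels 180336c1, 13872bk1)] -/
theorem bsdp_t180336c1_of_bsdp_t13872bk1_hasseWeil
    (hKO : KrausOesterle1992.prop4_torsionIso_of_congruences_hasseWeil)
    (hBCS : burungale_castella_skinner_charIdeal_eq_padicLFunction)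
    (hGr : greenberg_charValue_rankZero) (h5 : realPeriodRat_eq_unit_mul_plusPeriod)
    (hGV : GreenbergVatsal2000.thm14_mainConjecture_transfer_of_torsionIso)
    (hS : Schneider1985_order_charGenerator) (hPR : perrinRiou_rankOne_leadingTerms)
    (hmodP : nonempty_modularParametrizationData) (hmodL : hasEntireLFunction_rat)
    (hGZK : rank_eq_analyticRank_of_analyticRank_le_one)
    (W A : WeierstrassCurve ℚ) [W.IsElliptic] [W.IsGloballyMinimal] [A.IsElliptic] [A.IsGloballyMinimal]
    [Fact (Nat.Prime 5)]
    (hW : W = ⟨0, 1, 0, 1475538, 2502647991⟩) (hA : A = ⟨0, 1, 0, 23, -22⟩)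
    (hran : W.analyticRank ≤ 1) (hrA : A.analyticRank ≤ 1) (hbsdA : BSDp A 5)
    (hSchA : A.analyticRank = 1 → ∀ Dh : PAdicHeightData A 5, Dh.IsCanonical → SchneiderConjecture Dh)
    (hcertA : ∀ [NeZero (A.conductorNorm ℤ)] (fA : CuspForm (Gamma0 (A.conductorNorm ℤ)) 2),
        IsNewformOf A fA → ∀ (ϖ : ℚ), (ϖ : ℝ) * A.realPeriodRat = plusPeriod fA →
      ∃ n : ℕ, ‖PowerSeries.coeff n
        (PowerSeries.C (ϖ : ℚ_[5]) * padicLFunction fA (unitRoot A 5 : ℚ_[5]))‖ = 1)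
    (hcong : ∀ (ℓ : ℕ) [Fact ℓ.Prime],
      6 * ℓ < KrausOesterle1992.gammaZeroIndex (KrausOesterle1992.modulus W A) →
      (padicValNat ℓ (W.conductorNorm ℤ * A.conductorNorm ℤ) = 0 →
          (5 : ℤ) ∣ W.frobeniusTrace ℓ - A.frobeniusTrace ℓ) ∧
        (padicValNat ℓ (W.conductorNorm ℤ * A.conductorNorm ℤ) = 1 →
          (5 : ℤ) ∣ W.LFunction ℓ * A.LFunction ℓ - (ℓ + 1)))
    (hC3 : W.analyticRank = 1 → ∀ Dh : PAdicHeightData W 5, Dh.IsCanonical → SchneiderConjecture Dh) :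
    BSDp W 5 := by
  have hIW : integralModelInt W = ⟨0, 1, 0, 1475538, 2502647991⟩ :=
    integralModelInt_eq_of_map_eq _ (by rw [hW]; ext <;> simp [WeierstrassCurve.map])
  have hIA : integralModelInt A = ⟨0, 1, 0, 23, -22⟩ :=
    integralModelInt_eq_of_map_eq _ (by rw [hA]; ext <;> simp [WeierstrassCurve.map])
  haveI : Fact (Nat.Prime 11) := ⟨by norm_num⟩
  exact bsdp_of_ainvs_of_bsdpPartner_of_congruences_of_analyticRank_le_one_hasseWeil hKO hBCS hGr h5 hGV hS hPR hmodP hmodL hGZK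
    0 1 0 1475538 2502647991 hIW
    0 1 0 23 (-22) hIA
    5 11 11 9 4 (by norm_num) (by decide +kernel) card_t180336c1_5 (by decide) (by decide)
    (by decide +kernel) card_t180336c1_11 (by decide) (by decide +kernel) card_t13872bk1_5 (by decide)
    hran hrA hbsdA hSchA hcertA hcong hC3

/-- **`BSD(E,5)`-side record for `180336c1` from `32368bb1`, RE-KEYED on the Hasse–Weil twin of Kraus–Oesterlé Prop. 4** (ARM-P register
R-20 `KO92-Prop4-(ii)b-frobeniusTrace-offset`; x9 GEN 47 census `HOME/b2b-bsdres-x9/g47/KO92-EXPOSURE-X9.md`): the record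
`bsdp_t180336c1_of_bsdp_t32368bb1` of `X9/HessePartnerRecordsO.lean` — same Cremona models, same kernel-decided data (its `card_*` / `isElliptic_*` /
`isGloballyMinimal_*` theorems are imported, not re-proved), same PUBLISHED and FINITE binders (see that docstring for every number) —
with (i) `hKO` := the corrected statement `KrausOesterle1992.prop4_torsionIso_of_congruences_hasseWeil` and (ii) the `v_ℓ(N_E N_A) = 1`
conjunct of the displayed list `hcong` over `W.LFunction ℓ * A.LFunction ℓ` — Mathlib's `WeierstrassCurve.LFunction`, whose prime
coefficient is the HASSE–WEIL `a_ℓ`, `= ±1` at the multiplicative curve (Kraus–Oesterlé, Math. Ann. 293, p. 263 L8–9) — instead of the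
tree's `frobeniusTrace` (`= 2 / 0` there, `X11b.LocalTorsion.frobeniusTrace_eq_two_of_split` / `…_zero_of_nonsplit`), which made the
original's `hcong` unsatisfiable at the simple prime(s) ℓ ∈ {3, 7, 13} of `N_E·N_A` and the original VACUOUS AS TYPED. Hasse–Weil `a_ℓ` is the
currency in which the two engines (PARI `ellap`; ENGINE D pure-Python BSGS/Mestre; kit j159498) CERTIFIED the list: no certificate changes.
Per pair; nothing booked; X9 stays typed. [cite: KrausOesterle1992, Prop. 4 (ii), pp. 263–264] [cite: GreenbergVatsal2000, Thm. (1.4) (arXiv p. 5)]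
[cite: Cremona2006, Table 1 (Cremona labels 180336c1, 32368bb1)] -/
theorem bsdp_t180336c1_of_bsdp_t32368bb1_hasseWeil
    (hKO : KrausOesterle1992.prop4_torsionIso_of_congruences_hasseWeil)
    (hBCS : burungale_castella_skinner_charIdeal_eq_padicLFunction)
    (hGr : greenberg_charValue_rankZero) (h5 : realPeriodRat_eq_unit_mul_plusPeriod)
    (hGV : GreenbergVatsal2000.thm14_mainConjecture_transfer_of_torsionIso)
    (hS : Schneider1985_order_charGenerator) (hPR : perrinRiou_rankOne_leadingTerms)
    (hmodP : nonempty_modularParametrizationData) (hmodL : hasEntireLFunction_rat)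
    (hGZK : rank_eq_analyticRank_of_analyticRank_le_one)
    (W A : WeierstrassCurve ℚ) [W.IsElliptic] [W.IsGloballyMinimal] [A.IsElliptic] [A.IsGloballyMinimal]
    [Fact (Nat.Prime 5)]
    (hW : W = ⟨0, 1, 0, 1475538, 2502647991⟩) (hA : A = ⟨0, -1, 0, -1030092, -376286852⟩)
    (hran : W.analyticRank ≤ 1) (hrA : A.analyticRank ≤ 1) (hbsdA : BSDp A 5)
    (hSchA : A.analyticRank = 1 → ∀ Dh : PAdicHeightData A 5, Dh.IsCanonical → SchneiderConjecture Dh)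
    (hcertA : ∀ [NeZero (A.conductorNorm ℤ)] (fA : CuspForm (Gamma0 (A.conductorNorm ℤ)) 2),
        IsNewformOf A fA → ∀ (ϖ : ℚ), (ϖ : ℝ) * A.realPeriodRat = plusPeriod fA →
      ∃ n : ℕ, ‖PowerSeries.coeff n
        (PowerSeries.C (ϖ : ℚ_[5]) * padicLFunction fA (unitRoot A 5 : ℚ_[5]))‖ = 1)
    (hcong : ∀ (ℓ : ℕ) [Fact ℓ.Prime],
      6 * ℓ < KrausOesterle1992.gammaZeroIndex (KrausOesterle1992.modulus W A) →
      (padicValNat ℓ (W.conductorNorm ℤ * A.conductorNorm ℤ) = 0 →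
          (5 : ℤ) ∣ W.frobeniusTrace ℓ - A.frobeniusTrace ℓ) ∧
        (padicValNat ℓ (W.conductorNorm ℤ * A.conductorNorm ℤ) = 1 →
          (5 : ℤ) ∣ W.LFunction ℓ * A.LFunction ℓ - (ℓ + 1)))
    (hC3 : W.analyticRank = 1 → ∀ Dh : PAdicHeightData W 5, Dh.IsCanonical → SchneiderConjecture Dh) :
    BSDp W 5 := by
  have hIW : integralModelInt W = ⟨0, 1, 0, 1475538, 2502647991⟩ :=
    integralModelInt_eq_of_map_eq _ (by rw [hW]; ext <;> simp [WeierstrassCurve.map])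
  have hIA : integralModelInt A = ⟨0, -1, 0, -1030092, -376286852⟩ :=
    integralModelInt_eq_of_map_eq _ (by rw [hA]; ext <;> simp [WeierstrassCurve.map])
  haveI : Fact (Nat.Prime 11) := ⟨by norm_num⟩
  exact bsdp_of_ainvs_of_bsdpPartner_of_congruences_of_analyticRank_le_one_hasseWeil hKO hBCS hGr h5 hGV hS hPR hmodP hmodL hGZK
    0 1 0 1475538 2502647991 hIW
    0 (-1) 0 (-1030092) (-376286852) hIA
    5 11 11 9 4 (by norm_num) (by decide +kernel) card_t180336c1_5 (by decide) (by decide)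
    (by decide +kernel) card_t180336c1_11 (by decide) (by decide +kernel) card_t32368bb1_5 (by decide)
    hran hrA hbsdA hSchA hcertA hcong hC3

/-- **`BSD(E,5)`-side record for `180336c1` from `13872bk1`, RE-KEYED on the Hasse–Weil twin of Kraus–Oesterlé Prop. 4** (ARM-P register
R-20 `KO92-Prop4-(ii)b-frobeniusTrace-offset`; x9 GEN 47 census `HOME/b2b-bsdres-x9/g47/KO92-EXPOSURE-X9.md`): the record
`bsdp_t180336c1_of_bsdp_h13872bk1_f1_m80_1` of `X9/HessePartnerRecordsO.lean` — same Cremona models, same kernel-decided data (its `card_*` / `isElliptic_*` /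
`isGloballyMinimal_*` theorems are imported, not re-proved), same PUBLISHED and FINITE binders (see that docstring for every number) —
with (i) `hKO` := the corrected statement `KrausOesterle1992.prop4_torsionIso_of_congruences_hasseWeil` and (ii) the `v_ℓ(N_E N_A) = 1`
conjunct of the displayed list `hcong` over `W.LFunction ℓ * A.LFunction ℓ` — Mathlib's `WeierstrassCurve.LFunction`, whose prime
coefficient is the HASSE–WEIL `a_ℓ`, `= ±1` at the multiplicative curve (Kraus–Oesterlé, Math. Ann. 293, p. 263 L8–9) — instead of the
tree's `frobeniusTrace` (`= 2 / 0` there, `X11b.LocalTorsion.frobeniusTrace_eq_two_of_split` / `…_zero_of_nonsplit`), which made the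
original's `hcong` unsatisfiable at the simple prime(s) ℓ ∈ {13} of `N_E·N_A` and the original VACUOUS AS TYPED. Hasse–Weil `a_ℓ` is the
currency in which the two engines (PARI `ellap`; ENGINE D pure-Python BSGS/Mestre; kit j159498) CERTIFIED the list: no certificate changes.
Per pair; nothing booked; X9 stays typed. [cite: KrausOesterle1992, Prop. 4 (ii), pp. 263–264] [cite: GreenbergVatsal2000, Thm. (1.4) (arXiv p. 5)]
[cite: Cremona2006, Table 1 (Cremona labels 180336c1, 13872bk1)] -/
theorem bsdp_t180336c1_of_bsdp_h13872bk1_f1_m80_1_hasseWeil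
    (hKO : KrausOesterle1992.prop4_torsionIso_of_congruences_hasseWeil)
    (hF : thm132_fiveCongruent_hessePencil)
    (hBCS : burungale_castella_skinner_charIdeal_eq_padicLFunction)
    (hGr : greenberg_charValue_rankZero) (h5 : realPeriodRat_eq_unit_mul_plusPeriod)
    (hGV : GreenbergVatsal2000.thm14_mainConjecture_transfer_of_torsionIso)
    (hS : Schneider1985_order_charGenerator) (hPR : perrinRiou_rankOne_leadingTerms)
    (hmodP : nonempty_modularParametrizationData) (hmodL : hasEntireLFunction_rat)
    (hGZK : rank_eq_analyticRank_of_analyticRank_le_one)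
    (W A F : WeierstrassCurve ℚ) [W.IsElliptic] [W.IsGloballyMinimal] [A.IsElliptic] [A.IsGloballyMinimal]
    [F.IsElliptic] [F.IsGloballyMinimal] [Fact (Nat.Prime 5)]
    (hW : W = ⟨0, 1, 0, 1475538, 2502647991⟩) (hA : A = ⟨0, 1, 0, 23, -22⟩)
    (hFm : F = ⟨0, -1, 0, -319613237, 108375160009⟩)
    (hran : W.analyticRank ≤ 1) (hrA : A.analyticRank = 1) (hrF0 : F.analyticRank = 0) (hbsdF : BSDp F 5)
    (hSchF : F.analyticRank = 1 → ∀ Dh : PAdicHeightData F 5, Dh.IsCanonical → SchneiderConjecture Dh)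
    (hLF : F.entireLFunction 1 / (F.realPeriodRat : ℂ) = (((72 : ℕ) : ℚ) : ℂ))
    (h4 : MvPolynomial.eval ![(-80 : ℚ), 1] (hesseC4 (-1088 : ℚ) (25568)) = (839993564449111984479350786529197463051436032 : ℚ))
    (h6 : MvPolynomial.eval ![(-80 : ℚ), 1] (hesseC6 (-1088 : ℚ) (25568)) = (-1198481398520875083057593554189157080454355297694329306727122468864 : ℚ))
    (hSchA : A.analyticRank = 1 → ∀ Dh : PAdicHeightData A 5, Dh.IsCanonical → SchneiderConjecture Dh)
    (hcertA : ∀ [NeZero (A.conductorNorm ℤ)] (fA : CuspForm (Gamma0 (A.conductorNorm ℤ)) 2),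
        IsNewformOf A fA → ∀ (ϖ : ℚ), (ϖ : ℝ) * A.realPeriodRat = plusPeriod fA →
      ∃ n : ℕ, ‖PowerSeries.coeff n
        (PowerSeries.C (ϖ : ℚ_[5]) * padicLFunction fA (unitRoot A 5 : ℚ_[5]))‖ = 1)
    (hcong : ∀ (ℓ : ℕ) [Fact ℓ.Prime],
      6 * ℓ < KrausOesterle1992.gammaZeroIndex (KrausOesterle1992.modulus W A) →
      (padicValNat ℓ (W.conductorNorm ℤ * A.conductorNorm ℤ) = 0 →
          (5 : ℤ) ∣ W.frobeniusTrace ℓ - A.frobeniusTrace ℓ) ∧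
        (padicValNat ℓ (W.conductorNorm ℤ * A.conductorNorm ℤ) = 1 →
          (5 : ℤ) ∣ W.LFunction ℓ * A.LFunction ℓ - (ℓ + 1)))
    (hC3 : W.analyticRank = 1 → ∀ Dh : PAdicHeightData W 5, Dh.IsCanonical → SchneiderConjecture Dh) :
    BSDp W 5 :=
  bsdp_t180336c1_of_bsdp_t13872bk1_hasseWeil hKO hBCS hGr h5 hGV hS hPR hmodP hmodL hGZK W A hW hA hran hrA.le
    (bsdp_t13872bk1_of_bsdp_h13872bk1_f1_m80_1 hF hBCS hGr h5 hGV hS hPR hmodP hmodL hGZK A F hA hFm hrA hrF0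
      hbsdF hSchF hLF h4 h6 hSchA)
    hSchA hcertA hcong hC3

/-- **`BSD(E,5)`-side record for `168948a1` from `12996j1`, RE-KEYED on the Hasse–Weil twin of Kraus–Oesterlé Prop. 4** (ARM-P register
R-20 `KO92-Prop4-(ii)b-frobeniusTrace-offset`; x9 GEN 47 census `HOME/b2b-bsdres-x9/g47/KO92-EXPOSURE-X9.md`): the record
`bsdp_t168948a1'` of `X9/S4DescentPairsZimmertE.lean` — same Cremona models, same kernel-decided data (its `card_*` / `isElliptic_*` /
`isGloballyMinimal_*` theorems are imported, not re-proved), same PUBLISHED and FINITE binders (see that docstring for every number) —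
with (i) `hKO` := the corrected statement `KrausOesterle1992.prop4_torsionIso_of_congruences_hasseWeil` and (ii) the `v_ℓ(N_E N_A) = 1`
conjunct of the displayed list `hcong` over `W.LFunction ℓ * A.LFunction ℓ` — Mathlib's `WeierstrassCurve.LFunction`, whose prime
coefficient is the HASSE–WEIL `a_ℓ`, `= ±1` at the multiplicative curve (Kraus–Oesterlé, Math. Ann. 293, p. 263 L8–9) — instead of the
tree's `frobeniusTrace` (`= 2 / 0` there, `X11b.LocalTorsion.frobeniusTrace_eq_two_of_split` / `…_zero_of_nonsplit`), which made the
original's `hcong` unsatisfiable at the simple prime(s) ℓ ∈ {13} of `N_E·N_A` and the original VACUOUS AS TYPED. Hasse–Weil `a_ℓ` is the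
currency in which the two engines (PARI `ellap`; ENGINE D pure-Python BSGS/Mestre; kit j127638) CERTIFIED the list: no certificate changes.
Per pair; nothing booked; X9 stays typed. [cite: KrausOesterle1992, Prop. 4 (ii), pp. 263–264] [cite: GreenbergVatsal2000, Thm. (1.4) (arXiv p. 5)]
[cite: Cremona2006, Table 1 (Cremona labels 168948a1, 12996j1)] -/
theorem bsdp_t168948a1_hasseWeil'
    (hKO : KrausOesterle1992.prop4_torsionIso_of_congruences_hasseWeil)
    (hBCS : burungale_castella_skinner_charIdeal_eq_padicLFunction)
    (hGr : greenberg_charValue_rankZero) (h5 : realPeriodRat_eq_unit_mul_plusPeriod)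
    (hGV : GreenbergVatsal2000.thm14_mainConjecture_transfer_of_torsionIso)
    (hS : Schneider1985_order_charGenerator) (hPR : perrinRiou_rankOne_leadingTerms)
    (hmodP : nonempty_modularParametrizationData) (hmodL : hasEntireLFunction_rat)
    (hGZK : rank_eq_analyticRank_of_analyticRank_le_one)
    (W A : WeierstrassCurve ℚ) [W.IsElliptic] [W.IsGloballyMinimal] [A.IsElliptic] [A.IsGloballyMinimal]
    [Fact (Nat.Prime 5)]
    (hW : W = ⟨0, 0, 0, -64838127, -448597462250⟩) (hA : A = ⟨0, 0, 0, -20577, -912247⟩)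
    (hr : W.analyticRank = 0) (hrA : A.analyticRank ≤ 1)
    {qA : ℚ} (hqA : shaAn A = (qA : ℂ)) (hvA : padicValRat 5 qA = 0)
    (hSelA : Nat.card (A.selmerGroup (5 : ℤ)) = 5 ^ A.analyticRank)
    (hSchA : A.analyticRank = 1 → ∀ Dh : PAdicHeightData A 5, Dh.IsCanonical → SchneiderConjecture Dh)
    (hcertA : ∀ [NeZero (A.conductorNorm ℤ)] (fA : CuspForm (Gamma0 (A.conductorNorm ℤ)) 2),
        IsNewformOf A fA → ∀ (ϖ : ℚ), (ϖ : ℝ) * A.realPeriodRat = plusPeriod fA →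
      ∃ n : ℕ, ‖PowerSeries.coeff n
        (PowerSeries.C (ϖ : ℚ_[5]) * padicLFunction fA (unitRoot A 5 : ℚ_[5]))‖ = 1)
    (hcong : ∀ (ℓ : ℕ) [Fact ℓ.Prime],
      6 * ℓ < KrausOesterle1992.gammaZeroIndex (KrausOesterle1992.modulus W A) →
      (padicValNat ℓ (W.conductorNorm ℤ * A.conductorNorm ℤ) = 0 →
          (5 : ℤ) ∣ W.frobeniusTrace ℓ - A.frobeniusTrace ℓ) ∧
        (padicValNat ℓ (W.conductorNorm ℤ * A.conductorNorm ℤ) = 1 →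
          (5 : ℤ) ∣ W.LFunction ℓ * A.LFunction ℓ - (ℓ + 1))) :
    BSDp W 5 := by
  -- re-derived through the generic layer (not through part E's `bsdp_t168948a1_of_bsdp_s12996j1_hasseWeil`, to keep
  -- this part's imports to part D): `hbsdA` is the Zimmert-certified descent record `bsdp_s12996j1`, as in the original.
  have hbsdA : BSDp A 5 := bsdp_s12996j1 hGZK A hA hrA hqA hvA hSelA
  have hIW : integralModelInt W = ⟨0, 0, 0, -64838127, -448597462250⟩ :=
    integralModelInt_eq_of_map_eq _ (by rw [hW]; ext <;> simp [WeierstrassCurve.map])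
  have hIA : integralModelInt A = ⟨0, 0, 0, -20577, -912247⟩ :=
    integralModelInt_eq_of_map_eq _ (by rw [hA]; ext <;> simp [WeierstrassCurve.map])
  haveI : Fact (Nat.Prime 7) := ⟨by norm_num⟩
  exact bsdp_of_ainvs_of_bsdpPartner_of_congruences_hasseWeil hKO hBCS hGr h5 hGV hS hPR hmodP hmodL hGZK
    0 0 0 (-64838127) (-448597462250) hIW
    0 0 0 (-20577) (-912247) hIA
    5 7 8 10 5 (by norm_num) (by decide +kernel) card_t168948a1_5 (by decide) (by decide)
    (by decide +kernel) card_t168948a1_7 (by decide) (by decide +kernel) card_s12996j1_5 (by decide)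
    hr hrA hbsdA hSchA hcertA hcong

end Summit.BirchSwinnertonDyer.Rank1Residual.X9

end
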